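import Literature.Probability.RandomPlanarGeometry.SAWIrreducibleBridgeSwap
import Literature.Probability.RandomPlanarGeometry.SAWIrreducibleBridgeGrowth
import HarnessLib

/-!
# The ratio limit theorem for irreducible bridges: `λ_{N+2}/λ_N → μ²` (lane R42 «IRR-RATIO»)

Topic `Literature/Probability/RandomPlanarGeometry` (continues `SAWIrreducibleBridgeSwap.lean` — R42.1/R42.2:
Kesten's swap preserves irreducibility —, `SAWBridgePatternRatio.lean` — the generic ratio engine
`Zd.thm732W_of_bounds`, the counting identity (7.3.6), `bridges_pattern_inputs` —, `SAWRatioLimit.lean` — Kesten's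
ratio lemma `tendsto_ratio_of_kesten` (Madras–Slade Lemma 7.3.1) — and `SAWIrreducibleBridgeGrowth.lean` —
`e^{-c√N} μ^N ≤ λ_N`, Corollary 4.4.5 `λ_N^{1/N} → μ`).

Source / rôle. Madras–Slade 1993, §7.3: Theorem 7.3.4 proves `a_{N+2}/a_N → μ²` for `a = c`, `c(0,x)`, `b`
(Lemma 7.3.1 + Theorem 7.3.2 + a trivial lower bound `φ_N ≥ c > 0`). For the IRREDUCIBLE bridge counts `λ_N`
no trivial lower bound on `λ_{N+2}/λ_N` is available (λ is the "prime" sequence of the renewal structure and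
satisfies no super-multiplicativity). This file (route R42 of a-idea-1 g9, `Sketch_G9.lean` 7a35a84ae73a8f73,
stubs R42.0/R42.3/R42.4 and the compositions R42-A/R42-B) closes the gap by an observation on Lemma 7.3.1
itself: **hypothesis (ii) `liminf φ_N > 0` is redundant** — from (7.3.1) `φ_N² − D/N ≤ φ_N φ_{N+2}` one has
`φ_N − φ_{N+2} ≤ D/(N φ_N)`, so with a fixed threshold `t = μ²/4` either `φ_N < t` or
`φ_N ≤ φ_{N+2} + (D⁺/t)/N`; small values of `φ` therefore propagate backwards as in the printed proof, and
`φ_N < μ²/4` at one large `N` forces `φ ≤ 5μ²/8` on a stretch of length `∝ N`, contradicting `a_N^{1/N} → μ`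
(`exists_ratio_lower_of_kesten`, `tendsto_ratio_of_kesten'`). With R42.0 (`λ_n ≥ 1`), R42.1/R42.2, R42.3 (the
`(V,Q)`-pattern inputs relative to `λ_N`, from Theorem 7.2.3 and `e^{-c√N} μ^N ≤ λ_N`) and Corollary 4.4.5 this
gives **`λ_{N+2}/λ_N → μ²` on every `ℤ^{d+2}`** (`tendsto_irreducibleBridgeCount_ratio_two`) — to our reading not
in print (Madras–Slade Theorem 7.3.4 lists `c_N`, `c_N(0,x)`, `b_N`; the one-step ratio for `λ` stays open,
cf. (7.3.14) which needs the renewal equation).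

## Contents (namespace `Literature.Probability.RandomPlanarGeometry.SAW.Zd`)
* `kesten_iter_backward_of_threshold`, **`exists_ratio_lower_of_kesten`**, **`tendsto_ratio_of_kesten'`**
  (next to the tree's `Zd.tendsto_ratio_of_kesten`) — Lemma 7.3.1 without (ii);
* `longHookWalk`, `longHookWalk_mem_irreducibleBridges`, `one_le_irreducibleBridgeCount` — R42.0: `λ_n ≥ 1` (`n ≥ 1`);
* `irrFam` (a-idea-1's engine family, body verbatim), `irreducible_pattern_inputs` — R42.3;
* `kesten_ineq_irreducible` — R42-A: (7.3.4) for `φ_N = λ_{N+2}/λ_N` ("Theorem 7.3.2 (e)");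
* **`tendsto_irreducibleBridgeCount_ratio_two`** — R42-B: `λ_{N+2}/λ_N → μ²`.
[cite: MadrasSlade1993, Lemma 7.3.1, Theorem 7.3.2 (proof), Theorem 7.2.3, Corollary 4.4.5]
-/

noncomputable section

open Finset Filter Topology
open scoped BigOperators
open Literature.Probability.LatticeModels Literature.Probability.Percolation

namespace Literature.Probability.RandomPlanarGeometry.SAW.Zd

variable {d : ℕ}

/-! ### Kesten's ratio lemma without the `liminf` hypothesis -/

/-- Conditional backward iteration of (7.3.3): if `φ_n − B/n ≤ φ_{n+2}` holds whenever `φ_n ≥ t`, then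
`φ_{m+2k} ≤ T` (`T ≥ t`) forces `φ_m ≤ T + kB/m`. [cite: MadrasSlade1993, Lemma 7.3.1 (proof)] -/
theorem kesten_iter_backward_of_threshold {φ : ℕ → ℝ} {B t T : ℝ} {N₁ : ℕ} (hB : 0 ≤ B) (htT : t ≤ T)
    (h : ∀ n, N₁ ≤ n → t ≤ φ n → φ n - B / n ≤ φ (n + 2)) :
    ∀ (k m : ℕ), N₁ ≤ m → 1 ≤ m → φ (m + 2 * k) ≤ T → φ m ≤ T + k * B / m := by
  intro k
  induction k with
  | zero => intro m _ _ h0; simpa using h0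
  | succ k ih =>
    intro m hm hm1 hend
    have e : m + 2 * (k + 1) = m + 2 + 2 * k := by ring
    rw [e] at hend
    have h2 := ih (m + 2) (by omega) (by omega) hend
    have hmpos : (0 : ℝ) < m := by exact_mod_cast hm1
    have h3 : (k : ℝ) * B / ((m + 2 : ℕ) : ℝ) ≤ k * B / m :=
      div_le_div_of_nonneg_left (by positivity) hmpos (by push_cast; linarith)
    have h4 : ((k + 1 : ℕ) : ℝ) * B / m = k * B / m + B / m := by push_cast; ring
    rw [h4]
    by_cases hφ : t ≤ φ m
    · have h1 := h m hm hφ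
      linarith
    · have hkB : 0 ≤ (k : ℝ) * B / m := by positivity
      have hBm : 0 ≤ B / m := by positivity
      linarith [not_le.1 hφ]

/-- **Hypothesis (ii) of Lemma 7.3.1 is redundant**: if `a_n > 0`, `a_n^{1/n} → μ > 0` and
`φ_n² − D/n ≤ φ_n φ_{n+2}` eventually (`φ_n = a_{n+2}/a_n`), then `φ_n ≥ μ²/4` eventually. Threshold split:
`φ_n < μ²/4` or `φ_n ≤ φ_{n+2} + (D⁺/(μ²/4) + 1)/n`; then the printed backward-propagation argument.
[cite: MadrasSlade1993, Lemma 7.3.1 (proof)] -/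
theorem exists_ratio_lower_of_kesten {a : ℕ → ℝ} {μ : ℝ} (hμ : 0 < μ) (ha : ∀ n, 0 < a n)
    (hlim : Tendsto (fun n : ℕ => a n ^ (1 / (n : ℝ))) atTop (𝓝 μ))
    (hiii : ∃ D : ℝ, ∀ᶠ n in atTop,
      (a (n + 2) / a n) ^ 2 - D / n ≤ (a (n + 2) / a n) * (a (n + 4) / a (n + 2))) :
    ∃ c : ℝ, 0 < c ∧ ∀ᶠ n in atTop, c ≤ a (n + 2) / a n := by
  set φ : ℕ → ℝ := fun n => a (n + 2) / a n with hφ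
  have hφpos : ∀ n, 0 < φ n := fun n => div_pos (ha _) (ha _)
  set ε : ℝ := 3 * μ ^ 2 / 8 with hε_def
  have hε : 0 < ε := by positivity
  set t : ℝ := μ ^ 2 - 2 * ε with ht_def
  have ht4 : t = μ ^ 2 / 4 := by rw [ht_def, hε_def]; ring
  have ht0 : 0 < t := by rw [ht4]; positivity
  ---- Step 1: conditional (7.3.3) with `B ≥ 2ε`
  obtain ⟨B, hB, hεB, N₁, h733⟩ : ∃ B : ℝ, 0 < B ∧ ε ≤ B / 2 ∧ ∃ N₁ : ℕ,
      ∀ n, N₁ ≤ n → t ≤ φ n → φ n - B / n ≤ φ (n + 2) := by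
    obtain ⟨D, hD⟩ := hiii
    obtain ⟨N, hN⟩ := eventually_atTop.1 hD
    refine ⟨max (max D 0 / t + 1) (2 * ε), lt_of_lt_of_le (by positivity) (le_max_left _ _),
      by linarith [le_max_right (max D 0 / t + 1) (2 * ε)], max N 1, fun n hn htn => ?_⟩
    have h2 := hN n (le_of_max_le_left hn)
    have hn1 : (1 : ℝ) ≤ n := by exact_mod_cast le_of_max_le_right hn
    have hnpos : (0 : ℝ) < n := by linarith
    have hφn : 0 < φ n := hφpos n
    change φ n ^ 2 - D / n ≤ φ n * φ (n + 2) at h2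
    have h3 : φ n - D / n / φ n ≤ φ (n + 2) := by
      have h31 : (φ n ^ 2 - D / n) / φ n ≤ φ (n + 2) := by
        rw [div_le_iff₀ hφn]; linarith
      have e : (φ n ^ 2 - D / n) / φ n = φ n - D / n / φ n := by
        field_simp
      linarith [h31, e]
    have h4 : D / n / φ n ≤ (max D 0 / t + 1) / n := by
      have h5 : D / n / φ n ≤ max D 0 / n / φ n :=
        div_le_div_of_nonneg_right (div_le_div_of_nonneg_right (le_max_left _ _) hnpos.le) hφn.le
      have h6 : max D 0 / n / φ n ≤ max D 0 / n / t :=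
        div_le_div_of_nonneg_left (by positivity) ht0 htn
      have h7 : max D 0 / n / t = (max D 0 / t) / n := by ring
      have h8 : (max D 0 / t) / n ≤ (max D 0 / t + 1) / n :=
        div_le_div_of_nonneg_right (by linarith) hnpos.le
      linarith
    have h9 : (max D 0 / t + 1) / n ≤ max (max D 0 / t + 1) (2 * ε) / n :=
      div_le_div_of_nonneg_right (le_max_left _ _) hnpos.le
    linarith
  refine ⟨t, ht0, ?_⟩
  ---- Step 2: the printed liminf argument, with the conditional backward iteration
  set q : ℝ := μ ^ 2 - ε with hq
  have hq0 : 0 < q := by rw [hq, hε_def]; nlinarith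
  have h2ε : 2 * ε < μ ^ 2 := by rw [hε_def]; nlinarith
  have hgap : 0 < 2 * Real.log μ - Real.log q := by
    have : Real.log q < Real.log (μ ^ 2) := Real.log_lt_log hq0 (by linarith)
    rw [Real.log_pow] at this; push_cast at this; linarith
  set gap := 2 * Real.log μ - Real.log q with hgap_def
  set K : ℝ := 4 * B / ε with hK
  have hK0 : 0 < K := by positivity
  set δ : ℝ := gap / (4 * K) with hδ_def
  have hδ : 0 < δ := by positivity
  obtain ⟨N₂, hN₂1, hlog⟩ := kesten_log_bounds hμ ha hlim hδ
  by_contra hcon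
  rw [not_eventually] at hcon
  simp only [not_le] at hcon
  obtain ⟨n, hn, hφn⟩ :=
    (frequently_atTop.1 hcon) (max (2 * max N₁ N₂) (⌈4 * B / ε⌉₊ + 1))
  change φ n < t at hφn
  have hnreal : 4 * B / ε ≤ n := by
    have h' : ((⌈4 * B / ε⌉₊ + 1 : ℕ) : ℝ) ≤ n := by exact_mod_cast le_of_max_le_right hn
    push_cast at h'
    linarith [Nat.le_ceil (4 * B / ε)]
  have hn2N : 2 * max N₁ N₂ ≤ n := le_of_max_le_left hn
  have hnN₁ : (N₁ : ℝ) ≤ n / 2 := by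
    have : ((2 * max N₁ N₂ : ℕ) : ℝ) ≤ n := by exact_mod_cast hn2N
    push_cast at this
    have h' : (N₁ : ℝ) ≤ max (N₁ : ℝ) N₂ := le_max_left _ _
    linarith
  have hnN₂ : (N₂ : ℝ) ≤ n / 2 := by
    have : ((2 * max N₁ N₂ : ℕ) : ℝ) ≤ n := by exact_mod_cast hn2N
    push_cast at this
    have h' : (N₂ : ℝ) ≤ max (N₁ : ℝ) N₂ := le_max_right _ _
    linarith
  have hnpos : (0 : ℝ) < n := by
    have : (1 : ℝ) ≤ N₂ := by exact_mod_cast hN₂1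
    linarith
  obtain ⟨M, hM⟩ : ∃ M : ℕ, M = ⌊ε * n / (2 * B)⌋₊ := ⟨_, rfl⟩
  have hMle : (M : ℝ) ≤ ε * n / (2 * B) := hM ▸ Nat.floor_le (by positivity)
  have hMge : ε * n / (2 * B) - 1 ≤ M := by
    have := Nat.lt_floor_add_one (ε * n / (2 * B)); rw [← hM] at this; linarith
  have h2le : 2 ≤ ε * n / (2 * B) := by
    rw [le_div_iff₀ (by positivity)]; rw [div_le_iff₀ hε] at hnreal; linarith
  have hM1 : (1 : ℝ) ≤ M := by linarith
  have hMn4 : (M : ℝ) ≤ n / 4 := by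
    refine le_trans hMle ?_
    rw [div_le_div_iff₀ (by positivity) (by norm_num)]
    have := mul_le_mul_of_nonneg_right hεB hnpos.le
    linarith
  have hnKM : (n : ℝ) ≤ K * M := by
    have h1 : ε * n / (4 * B) ≤ M := by
      have e : ε * n / (2 * B) - ε * n / (4 * B) = ε * n / (4 * B) := by ring
      have h2 : (1 : ℝ) ≤ ε * n / (4 * B) := by
        rw [le_div_iff₀ (by positivity)]; rw [le_div_iff₀ (by positivity)] at h2le; linarith
      linarith
    rw [div_le_iff₀ (by positivity)] at h1
    rw [hK, div_mul_eq_mul_div, le_div_iff₀ hε]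
    linarith
  have h2Mn : 2 * M ≤ n := by
    have : (2 * M : ℝ) ≤ n := by linarith
    exact_mod_cast this
  obtain ⟨n₀, hn₀⟩ : ∃ n₀ : ℕ, n = n₀ + 2 * M := ⟨n - 2 * M, by omega⟩
  subst hn₀
  push_cast at hMn4 hnN₁ hnN₂ hnpos hnKM hMle
  have hn₀N₁ : N₁ ≤ n₀ := by
    have : (N₁ : ℝ) ≤ n₀ := by linarith
    exact_mod_cast this
  have hn₀N₂ : N₂ ≤ n₀ := by
    have : (N₂ : ℝ) ≤ n₀ := by linarith
    exact_mod_cast this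
  have hn₀1 : 1 ≤ n₀ := le_trans hN₂1 hn₀N₂
  have hn₀pos : (0 : ℝ) < n₀ := by exact_mod_cast hn₀1
  have hn₀ge : ((n₀ : ℝ) + 2 * M) / 2 ≤ n₀ := by linarith
  have hstay : ∀ k < M, a (n₀ + 2 * k + 2) / a (n₀ + 2 * k) ≤ q := by
    intro k hk
    have h1 := kesten_iter_backward_of_threshold hB.le le_rfl h733 (M - k) (n₀ + 2 * k) (by omega) (by omega)
      (by rw [show n₀ + 2 * k + 2 * (M - k) = n₀ + 2 * M by omega]; exact hφn.le)
    have h2 : ((M - k : ℕ) : ℝ) * B / ((n₀ + 2 * k : ℕ) : ℝ) ≤ M * B / n₀ := by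
      have hA : ((M - k : ℕ) : ℝ) ≤ M := by exact_mod_cast Nat.sub_le M k
      have hB' : (n₀ : ℝ) ≤ ((n₀ + 2 * k : ℕ) : ℝ) := by exact_mod_cast Nat.le_add_right _ _
      calc ((M - k : ℕ) : ℝ) * B / ((n₀ + 2 * k : ℕ) : ℝ)
          ≤ M * B / ((n₀ + 2 * k : ℕ) : ℝ) :=
            div_le_div_of_nonneg_right (mul_le_mul_of_nonneg_right hA hB.le) (by positivity)
        _ ≤ M * B / n₀ := div_le_div_of_nonneg_left (by positivity) hn₀pos hB'
    have h3 : (M : ℝ) * B / n₀ ≤ ε := by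
      rw [div_le_iff₀ hn₀pos]
      have h4 := mul_le_mul_of_nonneg_right hMle hB.le
      have e2 : ε * ((n₀ : ℝ) + 2 * M) / (2 * B) * B = ε * (((n₀ : ℝ) + 2 * M) / 2) := by
        field_simp
      rw [e2] at h4
      have := mul_le_mul_of_nonneg_left hn₀ge hε.le
      linarith
    change φ (n₀ + 2 * k) ≤ q
    rw [hq]
    have : φ (n₀ + 2 * k) ≤ t + ((M - k : ℕ) : ℝ) * B / ((n₀ + 2 * k : ℕ) : ℝ) := h1
    rw [ht_def] at this
    linarith
  have hprod := kesten_prod_le ha hstay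
  have hlog1 : Real.log (a (n₀ + 2 * M)) ≤ M * Real.log q + Real.log (a n₀) := by
    have := Real.log_le_log (ha _) hprod
    rwa [Real.log_mul (pow_pos hq0 M).ne' (ha n₀).ne', Real.log_pow] at this
  obtain ⟨hlo, -⟩ := hlog (n₀ + 2 * M) (by omega)
  obtain ⟨-, hhi⟩ := hlog n₀ hn₀N₂
  push_cast at hlo
  have h1 : (M : ℝ) * gap ≤ 2 * δ * ((n₀ : ℝ) + 2 * M) := by
    have hδM : 0 ≤ δ * (M : ℝ) := by positivity
    rw [hgap_def]; linarith
  have h2 : 2 * δ * K = gap / 2 := by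
    rw [hδ_def]; field_simp; ring
  have h3 : 2 * δ * ((n₀ : ℝ) + 2 * M) ≤ 2 * δ * (K * M) :=
    mul_le_mul_of_nonneg_left hnKM (by positivity)
  have h4 : (M : ℝ) * gap ≤ gap / 2 * M := by
    calc (M : ℝ) * gap ≤ 2 * δ * (K * M) := le_trans h1 h3
      _ = (2 * δ * K) * M := by ring
      _ = gap / 2 * M := by rw [h2]
  have h5 : 0 < (M : ℝ) * gap := mul_pos (by linarith) hgap
  linarith

/-- **Kesten's ratio lemma (Madras–Slade Lemma 7.3.1) WITHOUT hypothesis (ii)**: `a_n > 0`, `a_n^{1/n} → μ > 0`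
and `φ_n² − D/n ≤ φ_n φ_{n+2}` eventually imply `φ_n = a_{n+2}/a_n → μ²`.
[cite: MadrasSlade1993, Lemma 7.3.1] -/
theorem tendsto_ratio_of_kesten' {a : ℕ → ℝ} {μ : ℝ} (hμ : 0 < μ) (ha : ∀ n, 0 < a n)
    (hlim : Tendsto (fun n : ℕ => a n ^ (1 / (n : ℝ))) atTop (𝓝 μ))
    (hiii : ∃ D : ℝ, ∀ᶠ n in atTop,
      (a (n + 2) / a n) ^ 2 - D / n ≤ (a (n + 2) / a n) * (a (n + 4) / a (n + 2))) :
    Tendsto (fun n : ℕ => a (n + 2) / a n) atTop (𝓝 (μ ^ 2)) :=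
  tendsto_ratio_of_kesten hμ ha hlim (exists_ratio_lower_of_kesten hμ ha hlim hiii) hiii

/-! ### R42.0: `λ_n ≥ 1` for `n ≥ 1` (the hook walk `e₁ e₂^{n-1}`) -/

/-- The hook walk `0, e₁, e₁ + e₂, e₁ + 2e₂, …, e₁ + (n−1)e₂` (frozen after time `n`).
[cite: MadrasSlade1993, Definition 4.2.1] -/
def longHookWalk (d n : ℕ) : ℕ → Site (d + 2) := fun i =>
  if i = 0 then 0 else mk2 1 (((min i n : ℕ) : ℤ) - 1)

/-- Values of the hook walk at positive times. [cite: MadrasSlade1993, Definition 4.2.1] -/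
theorem longHookWalk_of_pos {n i : ℕ} (hi : 1 ≤ i) :
    longHookWalk d n i = mk2 1 (((min i n : ℕ) : ℤ) - 1) := by
  simp [longHookWalk, show i ≠ 0 by omega]

/-- The hook walk is an irreducible `n`-step bridge (`n ≥ 1`): heights `0, 1, 1, …, 1`, so no time in
`[1, n−1]` is a renewal time. [cite: MadrasSlade1993, Definition 4.2.1] -/
theorem longHookWalk_mem_irreducibleBridges {n : ℕ} (hn : 1 ≤ n) :
    longHookWalk d n ∈ irreducibleBridges (d + 2) n := by
  have h0 : longHookWalk d n 0 = 0 := by simp [longHookWalk]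
  have hx : ∀ i, 1 ≤ i → longHookWalk d n i 0 = 1 := fun i hi => by
    rw [longHookWalk_of_pos hi, mk2_apply_zero]
  have hsaw : longHookWalk d n ∈ saws (d + 2) n := by
    refine mem_saws.2 ⟨h0, fun i hi => ?_, fun i hi => ?_, ?_⟩
    · rw [longHookWalk_of_pos (hn.trans hi), longHookWalk_of_pos hn, min_eq_right hi, min_self]
    · rcases Nat.eq_zero_or_pos i with rfl | hi0
      · rw [h0, longHookWalk_of_pos le_rfl, show ((min 1 n : ℕ) : ℤ) - 1 = 0 by rw [min_eq_left hn]; simp]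
        have := adj_add_mk2 (0 : Site (d + 2)) (a := 0) (b := 0) (a' := 1) (b' := 0) (Or.inl ⟨by ring, rfl⟩)
        simpa [mk2] using this
      · rw [longHookWalk_of_pos hi0, longHookWalk_of_pos (by omega), min_eq_left hi.le, min_eq_left (by omega)]
        have := adj_add_mk2 (0 : Site (d + 2)) (a := 1) (b := (i : ℤ) - 1) (a' := 1) (b' := ((i + 1 : ℕ) : ℤ) - 1)
          (Or.inr (Or.inr (Or.inl ⟨rfl, by push_cast; ring⟩)))
        simpa using this
    · intro i hi j hj hij
      simp only [Set.mem_setOf_eq] at hi hj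
      rcases Nat.eq_zero_or_pos i with rfl | hi0 <;> rcases Nat.eq_zero_or_pos j with rfl | hj0
      · rfl
      · exfalso
        have := congrFun hij 0
        rw [h0, hx j hj0] at this
        simp at this
      · exfalso
        have := congrFun hij 0
        rw [h0, hx i hi0] at this
        simp at this
      · rw [longHookWalk_of_pos hi0, longHookWalk_of_pos hj0, min_eq_left hi, min_eq_left hj] at hij
        have := (mk2_inj hij).2
        omega
  have hb : longHookWalk d n ∈ bridges (d + 2) n := by
    refine mem_bridges.2 ⟨hsaw, fun i hi1 hi2 => ?_⟩
    rw [h0, hx i hi1, hx n hn]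
    simp
  refine mem_irreducibleBridges.2 ⟨hb, hn, (mem_bridges.1 hb).2, fun r hr1 hr2 hren => ?_⟩
  have h := hren.heights.2 (r + 1) (by omega) (by omega)
  rw [hx r hr1, hx (r + 1) (by omega)] at h
  exact lt_irrefl _ h

/-- **R42.0 — `λ_n ≥ 1` for `n ≥ 1`** on `ℤ^{d+2}`. [cite: MadrasSlade1993, Definition 4.2.1] -/
theorem one_le_irreducibleBridgeCount {n : ℕ} (hn : 1 ≤ n) : 1 ≤ irreducibleBridgeCount (d + 2) n :=
  Finset.card_pos.2 ⟨_, longHookWalk_mem_irreducibleBridges (d := d) hn⟩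

/-! ### The engine family `W_N = Λ_N` (with `W_0 = B_0`) and R42.3 -/

open Classical in
/-- The engine family of route R42 (a-idea-1 g9, body verbatim): irreducible bridges, with the `0`-step bridge
at level `0` (`λ_0 = 0` would break the engine's positivity hypothesis; levels `< 9` never meet the swap since
`OccU n ω k` forces `k + 9 ≤ n`). [cite: MadrasSlade1993, Theorem 7.3.2 (proof: "let W_N be …")] -/
def irrFam (d : ℕ) (n : ℕ) : Finset (ℕ → Site (d + 2)) :=
  if n = 0 then bridges (d + 2) 0 else irreducibleBridges (d + 2) n

/-- `W_n = Λ_n` for `n ≠ 0`. [cite: MadrasSlade1993, Theorem 7.3.2 (proof)] -/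
theorem irrFam_of_ne {n : ℕ} (hn : n ≠ 0) : irrFam d n = irreducibleBridges (d + 2) n := by
  simp [irrFam, hn]

/-- `|W_n| = λ_n` for `n ≠ 0`. [cite: MadrasSlade1993, Theorem 7.3.2 (proof)] -/
theorem card_irrFam_of_ne {n : ℕ} (hn : n ≠ 0) :
    (irrFam d n).card = irreducibleBridgeCount (d + 2) n := by
  rw [irrFam_of_ne hn]; rfl

/-- `W_n ⊆ B_n`. [cite: MadrasSlade1993, Theorem 7.3.2 (proof)] -/
theorem irrFam_subset_bridges (n : ℕ) : irrFam d n ⊆ bridges (d + 2) n := by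
  rcases Nat.eq_zero_or_pos n with rfl | hn
  · simp [irrFam]
  · rw [irrFam_of_ne hn.ne']; exact irreducibleBridges_subset_bridges n

/-- **R42.0 for the engine family**: `|W_n| > 0` for all `n`. [cite: MadrasSlade1993, Theorem 7.3.2 (proof)] -/
theorem irrFam_pos (d n : ℕ) : 0 < (irrFam d n).card := by
  rcases Nat.eq_zero_or_pos n with rfl | hn
  · simp only [irrFam, if_true]
    exact one_le_bridgeCount (d := d + 2) 0
  · rw [card_irrFam_of_ne hn.ne']; exact one_le_irreducibleBridgeCount hn

/-- `|W_n| ≤ μ^n`. [cite: MadrasSlade1993, eq. (1.2.17) and Definition 4.2.1] -/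
theorem card_irrFam_le_pow (n : ℕ) : ((irrFam d n).card : ℝ) ≤ connectiveConstant (d + 2) ^ n :=
  le_trans (by exact_mod_cast Finset.card_le_card (irrFam_subset_bridges (d := d) n)) (bridgeCount_le_pow n)

/-- Kesten's swap closes the engine family (R42.1 transported). [cite: MadrasSlade1993, Theorem 7.3.2 (proof)] -/
theorem insV_mem_irrFam {n k : ℕ} {ω : ℕ → Site (d + 2)} (hω : ω ∈ irrFam d n) (hk : OccU n ω k) :
    insV k ω ∈ irrFam d (n + 2) := by
  have hn : n ≠ 0 := by have := hk.1; omega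
  rw [irrFam_of_ne hn] at hω
  rw [irrFam_of_ne (by omega)]
  exact insV_mem_irreducibleBridges hω hk

/-- The inverse swap closes the engine family (R42.2 transported). [cite: MadrasSlade1993, Theorem 7.3.2 (proof)] -/
theorem delV_mem_irrFam {n k : ℕ} {ω : ℕ → Site (d + 2)} (hω : ω ∈ irrFam d (n + 2))
    (hk : OccV (n + 2) ω k) : delV k ω ∈ irrFam d n := by
  have hn : n ≠ 0 := by have := hk.1; omega
  rw [irrFam_of_ne (by omega)] at hω
  rw [irrFam_of_ne hn]
  exact delV_mem_irreducibleBridges hω hk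

/-- **R42.3 — the two pattern-theorem inputs of the engine for `W = Λ`** (shape of `Zd.bridges_pattern_inputs`):
Kesten's pattern theorem for `(V,Q)` on walks (`thm723`, (7.3.12)) made relative to `λ_N` through
`e^{-c√N} μ^N ≤ λ_N` (`N ≥ 3`, `Zd.exp_mul_pow_le_irreducibleBridgeCount`) and `λ_N ≤ μ^N`, with `Zd.decay_bound`.
[cite: MadrasSlade1993, Theorem 7.3.2 (proof, eqs. (7.3.5), (7.3.11)–(7.3.12)); Corollary 4.4.5 (proof)] -/
theorem irreducible_pattern_inputs (d : ℕ) : ∃ a C C' : ℝ, 0 < a ∧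
    (∀ n : ℕ, 1 ≤ n →
      ((((irrFam d n).filter fun ω => (vCount n ω : ℝ) < a * n).card : ℝ)) ≤
        C * (irrFam d n).card / (n : ℝ) ^ 3) ∧
    (∀ᶠ N : ℕ in atTop,
      3 * ((irrFam d (N + 2)).card : ℝ) *
          (((irrFam d (N + 2)).filter fun ω => ¬ 1 ≤ vCount (N + 2) ω).card : ℝ) /
        ((irrFam d N).card : ℝ) ^ 2 ≤ C' / N) := by
  classical
  obtain ⟨q, hq, ε, hε, hε1, N₀, hN₀⟩ := thm723 d
  set μ := connectiveConstant (d + 2) with hμdef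
  have hμ1 : 1 ≤ μ := one_le_connectiveConstant (d + 2)
  have hμ0 : 0 < μ := by linarith
  -- the lower bound `e^{-c√n} μ^n ≤ λ_n` for `n ≥ 3`, with `c ≥ 0`
  obtain ⟨c₀, hc₀⟩ := exp_mul_pow_le_irreducibleBridgeCount (d := d + 2) (by omega)
  set c := max c₀ 0 with hcdef
  have hc0 : 0 ≤ c := le_max_right _ _
  have hHW : ∀ n : ℕ, 3 ≤ n → Real.exp (-(c * Real.sqrt n)) * μ ^ n ≤ (irrFam d n).card := fun n hn => by
    rw [card_irrFam_of_ne (show n ≠ 0 by omega)]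
    refine le_trans ?_ (hc₀ n hn)
    apply mul_le_mul_of_nonneg_right _ (by positivity)
    apply Real.exp_le_exp.2
    have := Real.sqrt_nonneg (n : ℝ)
    nlinarith [le_max_left c₀ 0]
  have hbpos : ∀ n, (0 : ℝ) < (irrFam d n).card := fun n => by exact_mod_cast irrFam_pos d n
  -- exponential bound on the few-pattern members, `n ≥ N₀`
  have hexpb : ∀ n, N₀ ≤ n →
      ((((irrFam d n).filter fun ω => vCount n ω ≤ n / q).card : ℝ)) ≤ ((1 - ε) * μ) ^ n := by
    intro n hn
    refine le_trans ?_ (hN₀ n hn)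
    exact_mod_cast Finset.card_le_card (Finset.filter_subset_filter _
      (fun ω hω => (mem_bridges.1 (irrFam_subset_bridges n hω)).1))
  -- `((1-ε)μ)^n ≤ (1-ε)^n e^{c√n} |W_n|` for `n ≥ 3`
  have hkey : ∀ n : ℕ, 3 ≤ n → ((1 - ε) * μ) ^ n ≤
      (1 - ε) ^ n * Real.exp (c * Real.sqrt n) * (irrFam d n).card := by
    intro n hn
    rw [mul_pow]
    have h1 : μ ^ n ≤ Real.exp (c * Real.sqrt n) * (irrFam d n).card := by
      have := hHW n hn
      rw [Real.exp_neg, inv_mul_le_iff₀ (Real.exp_pos _)] at this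
      exact this
    calc (1 - ε) ^ n * μ ^ n ≤ (1 - ε) ^ n * (Real.exp (c * Real.sqrt n) * (irrFam d n).card) :=
          mul_le_mul_of_nonneg_left h1 (pow_nonneg (by linarith) _)
      _ = _ := by ring
  -- decay constants
  obtain ⟨D₁, hD₁⟩ := decay_bound (r := 1 - ε) (by linarith) (by linarith) c 3
  obtain ⟨D₂, hD₂⟩ := decay_bound (r := 1 - ε) (by linarith) (by linarith) (2 * c) 1
  have hD₁0 : 0 ≤ D₁ := le_trans (by positivity) (hD₁ 0)
  set N₁ := max N₀ 3 with hN₁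
  refine ⟨1 / (2 * q), max D₁ ((N₁ : ℝ) ^ 3), 3 * μ ^ 4 * (1 - ε) ^ 2 * D₂, by positivity, ?_, ?_⟩
  · -- (Ξ): the polynomial pattern bound relative to `|W_n|`
    intro n hn
    have hn0 : (0 : ℝ) < n := by exact_mod_cast hn
    have hsub := Finset.card_le_card (filter_vCount_lt_subset (d := d) hq (irrFam d n) n)
    have hb := hbpos n
    rcases le_or_gt N₁ n with hbig | hsmall
    · have hnN₀ : N₀ ≤ n := le_trans (le_max_left _ _) hbig
      have hn3 : 3 ≤ n := le_trans (le_max_right _ _) hbig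
      calc ((((irrFam d n).filter fun ω => (vCount n ω : ℝ) < 1 / (2 * q) * n).card : ℝ))
          ≤ (((irrFam d n).filter fun ω => vCount n ω ≤ n / q).card : ℝ) := by exact_mod_cast hsub
        _ ≤ ((1 - ε) * μ) ^ n := hexpb n hnN₀
        _ ≤ (1 - ε) ^ n * Real.exp (c * Real.sqrt n) * (irrFam d n).card := hkey n hn3
        _ = ((1 - ε) ^ n * (n : ℝ) ^ 3 * Real.exp (c * Real.sqrt n)) * (irrFam d n).card / (n : ℝ) ^ 3 := by
            field_simp
        _ ≤ D₁ * (irrFam d n).card / (n : ℝ) ^ 3 := by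
            apply div_le_div_of_nonneg_right _ (by positivity)
            exact mul_le_mul_of_nonneg_right (hD₁ n) hb.le
        _ ≤ max D₁ ((N₁ : ℝ) ^ 3) * (irrFam d n).card / (n : ℝ) ^ 3 := by
            apply div_le_div_of_nonneg_right _ (by positivity)
            exact mul_le_mul_of_nonneg_right (le_max_left _ _) hb.le
    · -- small `n`: trivial bound `≤ |W_n| ≤ N₁³ |W_n| / n³`
      have h1 : ((((irrFam d n).filter fun ω => (vCount n ω : ℝ) < 1 / (2 * q) * n).card : ℝ)) ≤
          (irrFam d n).card := by
        exact_mod_cast Finset.card_filter_le _ _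
      have h2 : ((irrFam d n).card : ℝ) ≤ (N₁ : ℝ) ^ 3 * (irrFam d n).card / (n : ℝ) ^ 3 := by
        rw [le_div_iff₀ (by positivity)]
        have : (n : ℝ) ^ 3 ≤ (N₁ : ℝ) ^ 3 := pow_le_pow_left₀ hn0.le (by exact_mod_cast hsmall.le) 3
        nlinarith
      have h3 : (N₁ : ℝ) ^ 3 * (irrFam d n).card / (n : ℝ) ^ 3 ≤
          max D₁ ((N₁ : ℝ) ^ 3) * (irrFam d n).card / (n : ℝ) ^ 3 := by
        apply div_le_div_of_nonneg_right _ (by positivity)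
        exact mul_le_mul_of_nonneg_right (le_max_right _ _) hb.le
      linarith
  · -- (S): `3 |W_{N+2}| Z_{N+2} / |W_N|² ≤ 3 μ⁴ (1-ε)^{N+2} e^{2c√N} ≤ C'/N`
    filter_upwards [eventually_ge_atTop (max N₁ 1)] with N hN
    have hN0 : N₀ ≤ N := le_trans (le_max_left _ _) (le_trans (le_max_left _ _) hN)
    have hN3 : 3 ≤ N := le_trans (le_max_right _ _) (le_trans (le_max_left _ _) hN)
    have hN1 : 1 ≤ N := le_trans (le_max_right _ _) hN
    have hNpos : (0 : ℝ) < N := by exact_mod_cast hN1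
    have hZ : (((irrFam d (N + 2)).filter fun ω => ¬ 1 ≤ vCount (N + 2) ω).card : ℝ) ≤
        ((1 - ε) * μ) ^ (N + 2) := by
      refine le_trans ?_ (hexpb (N + 2) (by omega))
      refine Nat.cast_le.2 (Finset.card_le_card fun ω => ?_)
      simp only [Finset.mem_filter, not_le, Nat.lt_one_iff]
      rintro ⟨hω, hv⟩
      exact ⟨hω, by rw [hv]; exact Nat.zero_le _⟩
    have hb2 : ((irrFam d (N + 2)).card : ℝ) ≤ μ ^ (N + 2) := card_irrFam_le_pow (N + 2)
    have hbN := hHW N hN3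
    have hbNpos := hbpos N
    have step1 : 3 * ((irrFam d (N + 2)).card : ℝ) *
        (((irrFam d (N + 2)).filter fun ω => ¬ 1 ≤ vCount (N + 2) ω).card : ℝ) ≤
        3 * μ ^ (N + 2) * ((1 - ε) * μ) ^ (N + 2) :=
      mul_le_mul (mul_le_mul_of_nonneg_left hb2 (by norm_num)) hZ (Nat.cast_nonneg _) (by positivity)
    have step2 : (Real.exp (-(c * Real.sqrt N)) * μ ^ N) ^ 2 ≤ ((irrFam d N).card : ℝ) ^ 2 :=
      pow_le_pow_left₀ (by positivity) hbN 2
    have hden : 0 < (Real.exp (-(c * Real.sqrt N)) * μ ^ N) ^ 2 := by positivity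
    have hexp1 : Real.exp (2 * c * Real.sqrt N) * Real.exp (-(c * Real.sqrt N)) ^ 2 = 1 := by
      rw [← Real.exp_nat_mul, ← Real.exp_add,
        show 2 * c * Real.sqrt N + ((2 : ℕ) : ℝ) * -(c * Real.sqrt N) = 0 by push_cast; ring,
        Real.exp_zero]
    have E : 3 * μ ^ (N + 2) * ((1 - ε) * μ) ^ (N + 2) =
        3 * μ ^ 4 * (1 - ε) ^ 2 * ((1 - ε) ^ N * Real.exp (2 * c * Real.sqrt N)) *
          (Real.exp (-(c * Real.sqrt N)) * μ ^ N) ^ 2 := by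
      calc 3 * μ ^ (N + 2) * ((1 - ε) * μ) ^ (N + 2)
          = 3 * μ ^ 4 * (1 - ε) ^ 2 * (1 - ε) ^ N * (μ ^ N) ^ 2 * 1 := by rw [mul_pow]; ring
        _ = 3 * μ ^ 4 * (1 - ε) ^ 2 * (1 - ε) ^ N * (μ ^ N) ^ 2 *
              (Real.exp (2 * c * Real.sqrt N) * Real.exp (-(c * Real.sqrt N)) ^ 2) := by rw [hexp1]
        _ = _ := by ring
    calc 3 * ((irrFam d (N + 2)).card : ℝ) *
          (((irrFam d (N + 2)).filter fun ω => ¬ 1 ≤ vCount (N + 2) ω).card : ℝ) /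
          ((irrFam d N).card : ℝ) ^ 2
        ≤ 3 * μ ^ (N + 2) * ((1 - ε) * μ) ^ (N + 2) / (Real.exp (-(c * Real.sqrt N)) * μ ^ N) ^ 2 :=
          div_le_div₀ (by positivity) step1 hden step2
      _ = 3 * μ ^ 4 * (1 - ε) ^ 2 * ((1 - ε) ^ N * Real.exp (2 * c * Real.sqrt N)) := by
          rw [div_eq_iff hden.ne', ← E]
      _ ≤ 3 * μ ^ 4 * (1 - ε) ^ 2 * (D₂ / N) := by
          apply mul_le_mul_of_nonneg_left _ (by positivity)
          rw [le_div_iff₀ hNpos]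
          have := hD₂ N
          rw [pow_one] at this
          nlinarith [this]
      _ = 3 * μ ^ 4 * (1 - ε) ^ 2 * D₂ / N := by ring

/-! ### R42-A and R42-B -/

/-- **R42-A — Kesten's inequality (7.3.4) for `φ_N = λ_{N+2}/λ_N`** on `ℤ^{d+2}` ("Theorem 7.3.2 (e)"): there is
`D` with `φ_N² − D/N ≤ φ_N φ_{N+2}` eventually, by the generic engine `Zd.thm732W_of_bounds` on `W = Λ`.
[cite: MadrasSlade1993, Theorem 7.3.2 (proof)] -/
theorem kesten_ineq_irreducible (d : ℕ) : ∃ D : ℝ, ∀ᶠ N : ℕ in atTop,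
    ((irreducibleBridgeCount (d + 2) (N + 2) : ℝ) / irreducibleBridgeCount (d + 2) N) ^ 2 - D / N ≤
      ((irreducibleBridgeCount (d + 2) (N + 2) : ℝ) / irreducibleBridgeCount (d + 2) N) *
        ((irreducibleBridgeCount (d + 2) (N + 4) : ℝ) / irreducibleBridgeCount (d + 2) (N + 2)) := by
  obtain ⟨a, C, C', ha, hPT, hS⟩ := irreducible_pattern_inputs d
  have h := thm732W_of_bounds (W := irrFam d) (fun hω hk => insV_mem_irrFam hω hk)
    (fun hω hk => delV_mem_irrFam hω hk) (irrFam_pos d) ha hPT hS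
  refine ⟨4 / a ^ 3 + 2 / a ^ 2 + 10 * C + C', ?_⟩
  filter_upwards [h, eventually_ge_atTop 1] with N hN hN1
  rw [card_irrFam_of_ne (show N ≠ 0 by omega), card_irrFam_of_ne (show N + 2 ≠ 0 by omega),
    card_irrFam_of_ne (show N + 4 ≠ 0 by omega)] at hN
  exact hN

/-- **R42-B — the ratio limit theorem for irreducible bridges: `λ_{N+2}/λ_N → μ²` on `ℤ^{d+2}`** (to our reading
not in print: Madras–Slade Theorem 7.3.4 covers `c`, `c(0,x)`, `b`). Lemma 7.3.1 WITHOUT its hypothesis (ii)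
(`tendsto_ratio_of_kesten'`) from Corollary 4.4.5 (`Zd.MadrasSlade1993_cor445`) and R42-A.
[cite: MadrasSlade1993, Lemma 7.3.1, Theorem 7.3.2, Corollary 4.4.5] -/
theorem tendsto_irreducibleBridgeCount_ratio_two (d : ℕ) :
    Tendsto (fun N : ℕ => (irreducibleBridgeCount (d + 2) (N + 2) : ℝ) / irreducibleBridgeCount (d + 2) N)
      atTop (𝓝 (connectiveConstant (d + 2) ^ 2)) := by
  have hμ := connectiveConstant_pos (d + 2)
  have key := tendsto_ratio_of_kesten' (a := fun n => ((irrFam d n).card : ℝ)) hμ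
    (fun n => by exact_mod_cast irrFam_pos d n) ?_ ?_
  · refine key.congr' ?_
    filter_upwards [eventually_ge_atTop 1] with n hn
    simp only [card_irrFam_of_ne (show n ≠ 0 by omega), card_irrFam_of_ne (show n + 2 ≠ 0 by omega)]
  · have h := MadrasSlade1993_cor445 (d := d + 2) (by omega)
    refine h.congr' ?_
    filter_upwards [eventually_ge_atTop 1] with n hn
    simp only [card_irrFam_of_ne (show n ≠ 0 by omega)]
  · obtain ⟨D, hD⟩ := kesten_ineq_irreducible d
    refine ⟨D, ?_⟩
    filter_upwards [hD, eventually_ge_atTop 1] with n hn hn1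
    simp only [card_irrFam_of_ne (show n ≠ 0 by omega), card_irrFam_of_ne (show n + 2 ≠ 0 by omega),
      card_irrFam_of_ne (show n + 4 ≠ 0 by omega)]
    exact hn

end Literature.Probability.RandomPlanarGeometry.SAW.Zd

end
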